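import Summits.Ventures.LatticeQCDFlow.Scaling.BooleanStarTwoStepContraction
import Summits.Ventures.LatticeQCDFlow.Scaling.BooleanStarColdStartLaw

/-!
HONEST FRAMING: exact (Metropolis-corrected) sampling algorithms for lattice gauge theory; figures
of merit are autocorrelation/cost numbers at stated couplings and volumes; no continuum-physics
claim.

# BooleanStarHubDominationLaw — THE COLD-START LAW OF THE BOOLEAN STAR UNDER HUB DOMINATION `p·μ_k ≤ μ_0` ALONE:
# `d(n) ≤ ((θ+K)/θ)·(1 − δ)^{⌊n/2⌋}`, `δ = min{(1−t)w_0(1−θ)·p·ct/m, ((1−t)w_0θ − (1−θ)t)/(K+θ)}` — NO ACCEPTANCE FLOOR,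
# NO VOLUME, NO REGIME; TUNED `t_mix(ε) ≤ 2⌈ρ⁻¹·log((1 + K(2t+h)/(2t))/ε)⌉`, `ρ = (th/(2t+h))·min{hpc/m, 1/(K+1)}`
# (lean-2 GEN-30, ours)

Venture-side (OURS).  Cell `lqcd-flow` (pub-lqcd), unit `pub-lqcd-lean-2-g30`, 2026-08-28.  Chapter P (OPEN-MATH-chapterM item 1 on
the two-point family), file 12.  Files 4–5 gave the law with the rate `(1−θ)·a·ct/m`, `a` = the least acceptance of an entry swap
between unequal contents; on the tight two-point witness `a = p(1−θ_A)/(1−pθ_A)`, but for general two-point laws `a` is not controlled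
by the domination constant.  This file replaces `a` by `(1−t)w_0·p` using the two-step contraction of `Scaling/BooleanStarTwoStepContraction`: the law is uniform over
ALL two-point laws with hub domination constant `p` (`p·μ_k(s) ≤ μ_0(s)`, the two-point identity-map reading of chapter M's one-sided
transported domination), at the price of one redraw factor `h = (1−t)w_0` in the entry rate and a halved exponent.

## What is proved

* §11 `lawMean_lawAt_le_of_twoStep_le` (generic: a non-negative function that is a supermartingale and contracts by `λ` over two
  steps decays like `λ^{⌊n/2⌋}` in mean), `boolSync_offDiag_le_dom` (`P{X_n ≠ Y_n} ≤ ((θ+K)/θ)(1−δ)^{⌊n/2⌋}`),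
  **`boolStar_worstTvDist_le_dom`** (THE LAW), **`boolStar_worstTvDist_le_dom_tuned`** (`θ = 2t/(2t+h)`:
  `d(n) ≤ (1 + K(2t+h)/(2t))·(1 − ρ)^{⌊n/2⌋}`, `ρ = (th/(2t+h))·min{hpc/m, 1/(K+1)}`), **`boolStar_mixingTime_le_dom`**
  (`t_mix(ε) ≤ 2⌈ρ⁻¹·log((1 + K(2t+h)/(2t))/ε)⌉` — `O((K + m/(hpc))·(1/t + 1/h)·log(K/ε))`, every quantity a scheme parameter or the
  domination constant).

Reading (no numerics implied): file 4 gives the conjectured entry rate of OPEN-MATH item 1, `Θ(th/(t+h))·min{ac/m, 1/(K+1)}`, with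
the acceptance floor `a` in place of the domination constant; this file gives `Θ(th/(t+h))·min{h·pc/m, 1/(K+1)}` — the domination
constant in place of `a`, one factor `h` short of the conjectured entry rate (the cost of waiting for a redraw when the common hub
content is the one whose healing entry is unlikely); both are volume-free, regime-free and polynomial in `K`, and this one is uniform
over the two-point laws given `p`.  Against file 5's floor `(m/(t·ĉ·p))·log((K+1)(1−ε−Kθ_A))` on the witness family the remaining
slack is in the scheme parameters (`(2t+h)/h`, here one more `1/h`), not in the laws and not in `K`.  Literature grade (cell rule):
OWN; cites the tree's `LevinPeres2017_cor_5_5`; no new bib keys.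
-/

noncomputable section

open Finset Function
open Literature.Probability.MarkovChains

namespace Summit.Ventures.LatticeQCDFlow.Scaling

variable {K m : ℕ} {μ : Fin (K + 1) → Bool → ℝ} {M : Fin (K + 1) → Bool → Bool → ℝ} {w : Fin (K + 1) → ℝ} {t : ℝ}

section Law
variable (κ : Fin m → Fin K)

/-! ## §11 The law under hub domination -/

/-- **Two-step decay in mean:** `Q` a transition matrix, `λ ≥ 0`, `QΦ ≤ Φ` and `Q²Φ ≤ λΦ` pointwise, `μ ≥ 0` ⇒
`E_{μQⁿ}Φ ≤ λ^{⌊n/2⌋}·E_μΦ`. [ours] -/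
theorem lawMean_lawAt_le_of_twoStep_le {X : Type*} [Fintype X] {Q : X → X → ℝ} (hQ : IsRowStochastic Q) {Φ : X → ℝ}
    {lam : ℝ} (hlam : 0 ≤ lam) (h1 : ∀ D, ∑ D', Q D D' * Φ D' ≤ Φ D)
    (h2 : ∀ D, ∑ D', Q D D' * ∑ D'', Q D' D'' * Φ D'' ≤ lam * Φ D) {μ : X → ℝ} (hμ : ∀ D, 0 ≤ μ D) :
    ∀ n : ℕ, lawMean (lawAt Q μ n) Φ ≤ lam ^ (n / 2) * lawMean μ Φ := by
  have hmono : ∀ ν : X → ℝ, (∀ D, 0 ≤ ν D) → lawMean (stepLaw Q ν) Φ ≤ lawMean ν Φ := fun ν hν => by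
    rw [lawMean_stepLaw]; exact sum_le_sum fun D _ => mul_le_mul_of_nonneg_left (h1 D) (hν D)
  have htwo : ∀ ν : X → ℝ, (∀ D, 0 ≤ ν D) → lawMean (stepLaw Q (stepLaw Q ν)) Φ ≤ lam * lawMean ν Φ := fun ν hν => by
    rw [lawMean_stepLaw, lawMean_stepLaw]
    calc lawMean ν (fun D => ∑ D', Q D D' * ∑ D'', Q D' D'' * Φ D'') ≤ lawMean ν (fun D => lam * Φ D) :=
          sum_le_sum fun D _ => mul_le_mul_of_nonneg_left (h2 D) (hν D)
      _ = lam * lawMean ν Φ := by unfold lawMean; rw [mul_sum]; exact sum_congr rfl fun D _ => by ring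
  have key : ∀ n : ℕ, lawMean (lawAt Q μ n) Φ ≤ lam ^ (n / 2) * lawMean μ Φ
      ∧ lawMean (lawAt Q μ (n + 1)) Φ ≤ lam ^ ((n + 1) / 2) * lawMean μ Φ := by
    intro n
    induction n with
    | zero =>
      refine ⟨?_, ?_⟩
      · rw [lawAt_zero, Nat.zero_div, pow_zero, one_mul]
      · rw [lawAt_succ, lawAt_zero, show (0 + 1) / 2 = 0 from rfl, pow_zero, one_mul]; exact hmono μ hμ
    | succ n ih =>
      refine ⟨ih.2, ?_⟩
      rw [lawAt_succ, lawAt_succ, show (n + 1 + 1) / 2 = n / 2 + 1 by omega, pow_succ]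
      calc lawMean (stepLaw Q (stepLaw Q (lawAt Q μ n))) Φ ≤ lam * lawMean (lawAt Q μ n) Φ :=
            htwo _ (lawAt_nonneg hQ hμ n)
        _ ≤ lam * (lam ^ (n / 2) * lawMean μ Φ) := mul_le_mul_of_nonneg_left ih.1 hlam
        _ = lam ^ (n / 2) * lam * lawMean μ Φ := by ring
  exact fun n => (key n).1

/-- **Disagreement probability of the coupled chain under hub domination:** from every pair `(x,y)`,
`P_{(x,y)}{X_n ≠ Y_n} ≤ ((θ + K)/θ)·(1 − δ)^{⌊n/2⌋}`, `δ = min{(1−t)w_0(1−θ)·p·ct/m, ((1−t)w_0θ − (1−θ)t)/(K+θ)}`. [ours] -/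
theorem boolSync_offDiag_le_dom (hm : 1 ≤ m) (ht0 : 0 ≤ t) (ht1 : t ≤ 1) (hw0 : ∀ k, 0 ≤ w k) (hw1 : ∑ k, w k = 1)
    (hμ : ∀ k x, 0 < μ k x) (hμ1 : ∀ k, ∑ u, μ k u = 1) (hM : ∀ k, IsRowStochastic (M k)) (hM0 : ∀ u v, M 0 u v = μ 0 v)
    {θ : ℝ} (hθ0 : 0 < θ) (hθ1 : θ ≤ 1) (hreg : (1 - θ) * t ≤ (1 - t) * w 0 * θ)
    {c : ℕ} (hc : ∀ p' : Fin K, c ≤ (univ.filter (fun r : Fin m => κ r = p')).card)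
    {α : Fin m → (Fin (K + 1) → Bool) → ℝ}
    (hα : ∀ r z, α r z = min 1 (tensorFun μ (edgeFlowSwap (Equiv.refl Bool) 0 (κ r).succ z) / tensorFun μ z))
    {p : ℝ} (hp0 : 0 ≤ p) (hp : ∀ (j : Fin K) (s : Bool), p * μ j.succ s ≤ μ 0 s)
    {Φ : (Fin (K + 1) → Bool) × (Fin (K + 1) → Bool) → ℝ}
    (hΦ : ∀ a, Φ a = ∑ k : Fin (K + 1), (if k = 0 then θ else 1) * (if a.1 k = a.2 k then (0 : ℝ) else 1))
    {Q : (Fin (K + 1) → Bool) × (Fin (K + 1) → Bool) → (Fin (K + 1) → Bool) × (Fin (K + 1) → Bool) → ℝ}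
    (hQ : ∀ a b, Q a b =
      ∑ r : Fin m, t / m *
        (min (α r a.1) (α r a.2) * (if b.1 = edgeFlowSwap (Equiv.refl Bool) 0 (κ r).succ a.1
              ∧ b.2 = edgeFlowSwap (Equiv.refl Bool) 0 (κ r).succ a.2 then (1 : ℝ) else 0)
          + (α r a.1 - min (α r a.1) (α r a.2)) * (if b.1 = edgeFlowSwap (Equiv.refl Bool) 0 (κ r).succ a.1 ∧ b.2 = a.2
              then (1 : ℝ) else 0)
          + (α r a.2 - min (α r a.1) (α r a.2)) * (if b.1 = a.1 ∧ b.2 = edgeFlowSwap (Equiv.refl Bool) 0 (κ r).succ a.2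
              then (1 : ℝ) else 0)
          + (1 - α r a.1 - α r a.2 + min (α r a.1) (α r a.2)) * (if b.1 = a.1 ∧ b.2 = a.2 then (1 : ℝ) else 0))
      + (1 - t) * ∑ k : Fin (K + 1), w k *
        (if a.1 k = a.2 k ∨ k = 0 then
            ∑ v : Bool, M k (a.1 k) v * (if b.1 = update a.1 k v ∧ b.2 = update a.2 k v then (1 : ℝ) else 0)
          else coordKernel M k a.1 b.1 * coordKernel M k a.2 b.2))
    (x y : Fin (K + 1) → Bool) (n : ℕ) :
    ∑ a, ∑ b ∈ univ.erase a, kernelAt Q n (x, y) (a, b)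
      ≤ (θ + K) / θ
        * (1 - min ((1 - t) * w 0 * (1 - θ) * p * c * t / m) (((1 - t) * w 0 * θ - (1 - θ) * t) / (K + θ))) ^ (n / 2) := by
  set δ := min ((1 - t) * w 0 * (1 - θ) * p * c * t / m) (((1 - t) * w 0 * θ - (1 - θ) * t) / (K + θ)) with hδ
  have hP : IsRowStochastic (fun y z : Fin (K + 1) → Bool =>
      t * ptGraphSwap μ (fun r : Fin m => (((0 : Fin (K + 1)), (κ r).succ) : Fin (K + 1) × Fin (K + 1)))
            (fun _ : Fin m => Equiv.refl Bool) y z + (1 - t) * prodKernel w M y z) :=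
    weightedScheme_isRowStochastic (ptGraphSwap_isRowStochastic hμ) hM hw0 hw1 ht0 ht1
  have hQc := boolSync_isMarkovianCoupling κ hm ht0 ht1 hw0 hμ hM hM0 hα hQ
  have hQs : IsRowStochastic Q := hQc.isRowStochastic hP
  have hstep1 := boolSync_step_potential_le_one κ hm ht0 ht1 hw0 hw1 hμ hM hθ0.le hθ1 hreg hα hΦ hQ
  have hstep2 := boolSync_twoStep_potential_le κ hm ht0 ht1 hw0 hw1 hμ hμ1 hM hM0 hθ0 hθ1 hreg hc hα hp0 hp hΦ hQ
  have hδ1 : 0 ≤ 1 - δ := by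
    have h2 : δ ≤ ((1 - t) * w 0 * θ - (1 - θ) * t) / (K + θ) := min_le_right _ _
    have h3 : ((1 - t) * w 0 * θ - (1 - θ) * t) / (K + θ) ≤ 1 := by
      rw [div_le_one (by positivity)]
      have hw01 : w 0 ≤ 1 := by
        calc w 0 ≤ ∑ k, w k := Finset.single_le_sum (fun k _ => hw0 k) (mem_univ 0)
          _ = 1 := hw1
      nlinarith [mul_nonneg (sub_nonneg.mpr ht1) (hw0 0), mul_nonneg (sub_nonneg.mpr hθ1) ht0, hθ0.le,
        mul_le_mul_of_nonneg_left hw01 (sub_nonneg.mpr ht1), Nat.cast_nonneg (α := ℝ) K]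
    linarith
  -- the mean potential decays geometrically at half speed
  have hdecay : ∑ b, kernelAt Q n (x, y) b * Φ b ≤ (1 - δ) ^ (n / 2) * Φ (x, y) := by
    have h := lawMean_lawAt_le_of_twoStep_le hQs hδ1 hstep1 hstep2 (μ := Pi.single (x, y) 1)
      (fun a => by rw [Pi.single_apply]; split_ifs <;> norm_num) n
    rw [lawMean_single] at h
    exact h
  have hK0 := (kernelAt_isRowStochastic hQs n).1 (x, y)
  calc ∑ a, ∑ b ∈ univ.erase a, kernelAt Q n (x, y) (a, b)
      ≤ ∑ a, ∑ b ∈ univ.erase a, kernelAt Q n (x, y) (a, b) * (Φ (a, b) / θ) :=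
        sum_le_sum fun a _ => sum_le_sum fun b hb => by
          have hne : a ≠ b := (ne_of_mem_erase hb).symm
          have hΦ' : 1 ≤ Φ (a, b) / θ := by rw [le_div_iff₀ hθ0, one_mul]; exact potential_ge_of_ne hθ0.le hθ1 hΦ hne
          simpa only [mul_one] using mul_le_mul_of_nonneg_left hΦ' (hK0 (a, b))
    _ ≤ ∑ a, ∑ b, kernelAt Q n (x, y) (a, b) * (Φ (a, b) / θ) :=
        sum_le_sum fun a _ => sum_le_sum_of_subset_of_nonneg (erase_subset _ _) fun b _ _ =>
          mul_nonneg (hK0 (a, b)) (div_nonneg (potential_nonneg hθ0.le hΦ (a, b)) hθ0.le)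
    _ = (∑ b, kernelAt Q n (x, y) b * Φ b) / θ := by
        rw [Fintype.sum_prod_type, Finset.sum_div]
        exact sum_congr rfl fun a _ => by rw [Finset.sum_div]; exact sum_congr rfl fun b _ => by ring
    _ ≤ (1 - δ) ^ (n / 2) * Φ (x, y) / θ := div_le_div_of_nonneg_right hdecay hθ0.le
    _ ≤ (1 - δ) ^ (n / 2) * (θ + K) / θ :=
        div_le_div_of_nonneg_right (mul_le_mul_of_nonneg_left (potential_le hθ0.le hΦ x y) (pow_nonneg hδ1 _)) hθ0.le
    _ = (θ + K) / θ * (1 - δ) ^ (n / 2) := by ring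

/-- **THE COLD-START LAW OF THE BOOLEAN STAR UNDER HUB DOMINATION (OPEN-MATH item 1 on the two-point family, uniformly in the
laws).**  Two-point replicas with positive laws `μ_k` summing to one, HUB DOMINATION `p·μ_k(s) ≤ μ_0(s)` (`k ≥ 1`, both `s`, `p ≥ 0`),
identity entry maps on the hub list `κ` (multiplicities `≥ c`), exact hot redraws, `μ_k`-reversible row-stochastic cold kernels,
`m ≥ 1`, `0 ≤ t ≤ 1`, `w` a probability vector, `0 < θ ≤ 1` with `(1−θ)t ≤ (1−t)w_0·θ`.  Then for every `n`,
**`d(n) ≤ ((θ + K)/θ)·(1 − min{(1−t)w_0·(1−θ)·p·c·t/m, ((1−t)w_0·θ − (1−θ)t)/(K+θ)})^{⌊n/2⌋}`** — NO acceptance floor, NO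
configuration-space volume, NO regime, polynomial in `K` (LPW Cor. 5.5 on the synchronous coupling, two-step contraction). [ours] -/
theorem boolStar_worstTvDist_le_dom (hm : 1 ≤ m) (ht0 : 0 ≤ t) (ht1 : t ≤ 1) (hw0 : ∀ k, 0 ≤ w k) (hw1 : ∑ k, w k = 1)
    (hμ : ∀ k x, 0 < μ k x) (hμ1 : ∀ k, ∑ u, μ k u = 1) (hM : ∀ k, IsRowStochastic (M k))
    (hMrev : ∀ k, DetailedBalance (μ k) (M k)) (hM0 : ∀ u v, M 0 u v = μ 0 v)
    {θ : ℝ} (hθ0 : 0 < θ) (hθ1 : θ ≤ 1) (hreg : (1 - θ) * t ≤ (1 - t) * w 0 * θ)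
    {c : ℕ} (hc : ∀ p' : Fin K, c ≤ (univ.filter (fun r : Fin m => κ r = p')).card)
    {p : ℝ} (hp0 : 0 ≤ p) (hp : ∀ (j : Fin K) (s : Bool), p * μ j.succ s ≤ μ 0 s) (n : ℕ) :
    worstTvDist (fun y z : Fin (K + 1) → Bool =>
        t * ptGraphSwap μ (fun r : Fin m => (((0 : Fin (K + 1)), (κ r).succ) : Fin (K + 1) × Fin (K + 1)))
              (fun _ : Fin m => Equiv.refl Bool) y z + (1 - t) * prodKernel w M y z) (tensorFun μ) n
      ≤ (θ + K) / θ
        * (1 - min ((1 - t) * w 0 * (1 - θ) * p * c * t / m) (((1 - t) * w 0 * θ - (1 - θ) * t) / (K + θ))) ^ (n / 2) := by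
  have hst := dominatedStar_isStationary κ (fun _ : Fin m => Equiv.refl Bool) (w := w) (M := M) ht0 ht1 hw0 hw1 hμ hM hMrev
  refine LevinPeres2017_cor_5_5 hst (fun x => (tensorFun_pos hμ x).le) (sum_tensorFun_eq_one μ hμ1) fun x y => ⟨_,
    boolSync_isMarkovianCoupling κ hm ht0 ht1 hw0 hμ hM hM0 (α := fun r z =>
      min 1 (tensorFun μ (edgeFlowSwap (Equiv.refl Bool) 0 (κ r).succ z) / tensorFun μ z)) (fun _ _ => rfl) (fun _ _ => rfl),
    boolSync_offDiag_le_dom κ hm ht0 ht1 hw0 hw1 hμ hμ1 hM hM0 hθ0 hθ1 hreg hc (fun _ _ => rfl) hp0 hp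
      (Φ := fun a => ∑ k : Fin (K + 1), (if k = 0 then θ else 1) * (if a.1 k = a.2 k then (0 : ℝ) else 1))
      (fun _ => rfl) (fun _ _ => rfl) x y n⟩

/-- **THE TUNED LAW UNDER HUB DOMINATION** (`θ = 2t/(2t+h)`, `h = (1−t)w_0`; `0 < t < 1`, `w_0 > 0`, `p ≥ 0`):
**`d(n) ≤ (1 + K(2t+h)/(2t))·(1 − (th/(2t+h))·min{hpc/m, 1/(K+1)})^{⌊n/2⌋}`**. [ours] -/
theorem boolStar_worstTvDist_le_dom_tuned (hm : 1 ≤ m) (ht0 : 0 < t) (ht1 : t < 1) (hw0 : ∀ k, 0 ≤ w k) (hw00 : 0 < w 0)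
    (hw1 : ∑ k, w k = 1) (hμ : ∀ k x, 0 < μ k x) (hμ1 : ∀ k, ∑ u, μ k u = 1) (hM : ∀ k, IsRowStochastic (M k))
    (hMrev : ∀ k, DetailedBalance (μ k) (M k)) (hM0 : ∀ u v, M 0 u v = μ 0 v)
    {c : ℕ} (hc : ∀ p' : Fin K, c ≤ (univ.filter (fun r : Fin m => κ r = p')).card)
    {p : ℝ} (hp0 : 0 ≤ p) (hp : ∀ (j : Fin K) (s : Bool), p * μ j.succ s ≤ μ 0 s) (n : ℕ) :
    worstTvDist (fun y z : Fin (K + 1) → Bool =>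
        t * ptGraphSwap μ (fun r : Fin m => (((0 : Fin (K + 1)), (κ r).succ) : Fin (K + 1) × Fin (K + 1)))
              (fun _ : Fin m => Equiv.refl Bool) y z + (1 - t) * prodKernel w M y z) (tensorFun μ) n
      ≤ (1 + K * (2 * t + (1 - t) * w 0) / (2 * t))
        * (1 - t * ((1 - t) * w 0) / (2 * t + (1 - t) * w 0)
          * min ((1 - t) * w 0 * p * c / m) (1 / (K + 1))) ^ (n / 2) := by
  set h := (1 - t) * w 0 with hh
  have hh0 : 0 < h := mul_pos (by linarith) hw00
  set θ := 2 * t / (2 * t + h) with hθ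
  have hθ0 : 0 < θ := by positivity
  have hθ1 : θ ≤ 1 := by rw [hθ, div_le_one (by positivity)]; linarith
  have h1θ : 1 - θ = h / (2 * t + h) := by rw [hθ]; field_simp; ring
  have hreg : (1 - θ) * t ≤ (1 - t) * w 0 * θ := by
    rw [h1θ, ← hh, hθ]
    rw [div_mul_eq_mul_div, mul_div_assoc', div_le_div_iff_of_pos_right (by positivity)]
    nlinarith [mul_pos ht0 hh0]
  have hmain := boolStar_worstTvDist_le_dom κ hm ht0.le ht1.le hw0 hw1 hμ hμ1 hM hMrev hM0 hθ0 hθ1 hreg hc hp0 hp n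
  have hmpos : (0 : ℝ) < m := Nat.cast_pos.mpr (by omega)
  have hrate : t * h / (2 * t + h) * min (h * p * c / m) (1 / (K + 1))
      ≤ min ((1 - t) * w 0 * (1 - θ) * p * c * t / m) (((1 - t) * w 0 * θ - (1 - θ) * t) / (K + θ)) := by
    refine le_min ?_ ?_
    · calc t * h / (2 * t + h) * min (h * p * c / m) (1 / (K + 1)) ≤ t * h / (2 * t + h) * (h * p * c / m) :=
            mul_le_mul_of_nonneg_left (min_le_left _ _) (by positivity)
        _ = (1 - t) * w 0 * (1 - θ) * p * c * t / m := by rw [h1θ, ← hh]; ring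
    · calc t * h / (2 * t + h) * min (h * p * c / m) (1 / (K + 1)) ≤ t * h / (2 * t + h) * (1 / (K + 1)) :=
            mul_le_mul_of_nonneg_left (min_le_right _ _) (by positivity)
        _ ≤ t * h / (2 * t + h) * (1 / (K + θ)) := by
            gcongr
        _ = ((1 - t) * w 0 * θ - (1 - θ) * t) / (K + θ) := by rw [← hh, h1θ, hθ]; field_simp; ring
  have hconst : (θ + K) / θ = 1 + K * (2 * t + h) / (2 * t) := by rw [hθ]; field_simp
  have hbase0 : 0 ≤ 1 - min ((1 - t) * w 0 * (1 - θ) * p * c * t / m) (((1 - t) * w 0 * θ - (1 - θ) * t) / (K + θ)) := by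
    have h2 : min ((1 - t) * w 0 * (1 - θ) * p * c * t / m) (((1 - t) * w 0 * θ - (1 - θ) * t) / (K + θ))
        ≤ ((1 - t) * w 0 * θ - (1 - θ) * t) / (K + θ) := min_le_right _ _
    have h3 : ((1 - t) * w 0 * θ - (1 - θ) * t) / (K + θ) ≤ 1 := by
      rw [div_le_one (by positivity)]
      have hw01 : w 0 ≤ 1 := by
        calc w 0 ≤ ∑ k, w k := Finset.single_le_sum (fun k _ => hw0 k) (mem_univ 0)
          _ = 1 := hw1
      nlinarith [mul_nonneg (sub_nonneg.mpr ht1.le) (hw0 0), mul_nonneg (sub_nonneg.mpr hθ1) ht0.le, hθ0.le,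
        mul_le_mul_of_nonneg_left hw01 (sub_nonneg.mpr ht1.le), Nat.cast_nonneg (α := ℝ) K]
    linarith
  calc _ ≤ (θ + K) / θ * (1 - min ((1 - t) * w 0 * (1 - θ) * p * c * t / m)
        (((1 - t) * w 0 * θ - (1 - θ) * t) / (K + θ))) ^ (n / 2) := hmain
    _ ≤ (1 + K * (2 * t + h) / (2 * t)) * (1 - t * h / (2 * t + h) * min (h * p * c / m) (1 / (K + 1))) ^ (n / 2) := by
        rw [hconst]
        exact mul_le_mul_of_nonneg_left (pow_le_pow_left₀ hbase0 (by linarith [hrate]) _) (by positivity)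

/-- **THE MIXING TIME OF THE BOOLEAN STAR UNDER HUB DOMINATION:** with `ρ = (th/(2t+h))·min{hpc/m, 1/(K+1)}` (`h = (1−t)w_0`,
`p > 0`, `c ≥ 1`), **`t_mix(ε) ≤ 2·⌈ρ⁻¹·log((1 + K(2t+h)/(2t))/ε)⌉`** for every `0 < ε` —
`O((K + m/(hpc))·(1/t + 1/h)·log(K/ε))`, uniformly over the two-point laws with hub domination constant `p`. [ours] -/
theorem boolStar_mixingTime_le_dom (hm : 1 ≤ m) (ht0 : 0 < t) (ht1 : t < 1) (hw0 : ∀ k, 0 ≤ w k) (hw00 : 0 < w 0)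
    (hw1 : ∑ k, w k = 1) (hμ : ∀ k x, 0 < μ k x) (hμ1 : ∀ k, ∑ u, μ k u = 1) (hM : ∀ k, IsRowStochastic (M k))
    (hMrev : ∀ k, DetailedBalance (μ k) (M k)) (hM0 : ∀ u v, M 0 u v = μ 0 v)
    {c : ℕ} (hc1 : 1 ≤ c) (hc : ∀ p' : Fin K, c ≤ (univ.filter (fun r : Fin m => κ r = p')).card)
    {p : ℝ} (hp0 : 0 < p) (hp : ∀ (j : Fin K) (s : Bool), p * μ j.succ s ≤ μ 0 s) {ε : ℝ} (hε : 0 < ε) :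
    mixingTime (fun y z : Fin (K + 1) → Bool =>
        t * ptGraphSwap μ (fun r : Fin m => (((0 : Fin (K + 1)), (κ r).succ) : Fin (K + 1) × Fin (K + 1)))
              (fun _ : Fin m => Equiv.refl Bool) y z + (1 - t) * prodKernel w M y z) (tensorFun μ) ε
      ≤ 2 * ⌈1 / (t * ((1 - t) * w 0) / (2 * t + (1 - t) * w 0) * min ((1 - t) * w 0 * p * c / m) (1 / (K + 1)))
          * Real.log ((1 + K * (2 * t + (1 - t) * w 0) / (2 * t)) / ε)⌉₊ := by
  set h := (1 - t) * w 0 with hh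
  have hh0 : 0 < h := mul_pos (by linarith) hw00
  have hmpos : (0 : ℝ) < m := Nat.cast_pos.mpr (by omega)
  set ρ := t * h / (2 * t + h) * min (h * p * c / m) (1 / (K + 1)) with hρ
  have hρ0 : 0 < ρ := by
    have : 0 < min (h * p * c / (m : ℝ)) (1 / ((K : ℝ) + 1)) := lt_min (by positivity) (by positivity)
    positivity
  have hρ1 : ρ ≤ 1 := by
    have h1 : t * h / (2 * t + h) ≤ 1 := by rw [div_le_one (by positivity)]; nlinarith [mul_pos ht0 hh0]
    have h2 : min (h * p * c / (m : ℝ)) (1 / ((K : ℝ) + 1)) ≤ 1 := (min_le_right _ _).trans (by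
      rw [div_le_one (by positivity)]; linarith [Nat.cast_nonneg (α := ℝ) K])
    have h3 : 0 ≤ min (h * p * c / (m : ℝ)) (1 / ((K : ℝ) + 1)) := le_min (by positivity) (by positivity)
    calc ρ ≤ 1 * 1 := mul_le_mul h1 h2 h3 zero_le_one
      _ = 1 := one_mul 1
  set N : ℕ := ⌈1 / ρ * Real.log ((1 + K * (2 * t + h) / (2 * t)) / ε)⌉₊ with hN
  have hd := boolStar_worstTvDist_le_dom_tuned κ hm ht0 ht1 hw0 hw00 hw1 hμ hμ1 hM hMrev hM0 hc hp0.le hp (2 * N)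
  rw [show 2 * N / 2 = N by omega] at hd
  refine mixingTime_le _ _ (hd.trans ?_)
  exact geom_le_of_ge_log hρ0 hρ1 (by positivity) hε (Nat.le_ceil _)

end Law

end Summit.Ventures.LatticeQCDFlow.Scaling

end
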